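import Literature.Geometry.Hyperkaehler.ComplexStructureAdaptedBasis
import Mathlib.Topology.Algebra.Module.FiniteDimension
import HarnessLib

/-!
# The cone `C_I` is not contained in any `Compl_Ω`, `Ω ≠ 0` (Buskin–Izadi, Lemma 3.3): the linearised equation
# `ᵗYΩ + ΩY = 0` on `T_J(G_I·J) ≅ {Y | YI = IY, YJ = −JY}` has a PROPER solution space

Topic `Literature/Geometry/Hyperkaehler`, namespace `Literature.Geometry.Hyperkaehler.TwistorConeLocus`. Written by the
literature seat `lit-w-verbitsky` (gen 15) of the cell `pub-hsemireg` (HodgeConjecture venture), 2026-08-25, as a kernel leg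
of rows V-V8 / V-V20 of that cell's Verbitsky table ([BI20]'s connectivity of the period domain of complex tori by GENERIC
twistor paths, Prop. 3.1: "Any two periods in the period domain `Compl` can be connected by a generic chain of twistor
lines" — the chains may be chosen so that the periods at the joints are generic tori, i.e. lie in no Hodge locus
`Compl_Ω`). The step that is finite-dimensional linear algebra is Lemma 3.3 ("For any nonzero alternating form `Ω`, the cone
`C_I` is not contained in `Compl_Ω`"), whose printed proof reduces it to a statement about the tangent space of the orbit
`G_I·J` at `J`; that statement is proved here. THEOREMS ONLY (no definition, no named fact, no `sorry`); imports the
tree's `ComplexStructureAdaptedBasis` (the block basis `{v, Jv, Iv, IJv}`) + Mathlib + HarnessLib. Nothing in this file is a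
statement about the Hodge conjecture, and nothing here says that any object of the cell is hyperholomorphic, rotable or
carries a twistor line.

## Source, verbatim (arXiv v2 = the cell's numbering of record; "v2 p.N Lm" = PDF page N, text-layer line m of
## arXiv:1806.07831v2, sha256/16 9e1097db4f2fd005; CAUTION: the held corpus text `paper:arxiv-1806.07831` is arXiv v1, where
## §3's lemmas are numbered differently: v2 Lemma 3.2 / 3.3 / 3.4 = v1 Lemma 3.3 / 3.4 / 3.2, and v1 states Lemma 3.4 in the
## "equivalent" local form that v2 moves into the proof)

N. Buskin, E. Izadi, *Twistor lines in the period domain of complex tori*, arXiv:1806.07831v2 (28 Jun 2020) = Geom. Dedicata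
213 (2021) 21–47 (journal pages unseen by the cell), §3 "Connectivity by generic twistor paths". Notation as in §1–§2
(`V_ℝ` real of dimension `4n`; `G = GL(V_ℝ)`; `G_I`, `G_ℍ = G_I ∩ G_J`; `I, J` a quaternionic pair, `I² = J² = −1`,
`IJ = −JI`; `C_I = ⋃_{g ∈ G_I} g·S(I, J)` the cone of twistor spheres through `I`; `V_I = T_eG_I/T_eG_ℍ`; `Xᴶ = J⁻¹XJ`).

* §3.2, v2 p.14 L29–35: "For an alternating form `Ω` on `V_ℝ` we denote by `Compl_Ω` the locus of periods in `Compl` at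
  which `Ω` represents a class of Hodge (1,1)-type, that is `Compl_Ω = {I ∈ Compl | Ω(I·, I·) = Ω(·, ·)}`. If we fix a basis
  of `V_ℝ` and switch to matrix descriptions, then the condition `Ω(I·, I·) = Ω(·, ·)` simply becomes `ᵗIΩI = Ω`".
* v2 p.14 L42–49: "**Lemma 3.2.** For any alternating form `Ω` and any twistor sphere `S`, the intersection `S ∩ Compl_Ω` is
  either finite or all of `S`. **Lemma 3.3.** For any nonzero alternating form `Ω`, the cone `C_I` is not contained in
  `Compl_Ω`. Lemma 3.3 immediately implies **Lemma 3.4.** For every `I ∈ Compl` the set of non-generic periods in `C_I`,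
  that is `C_I ∩ L_NS`, is a countable union of closed subsets of `C_I` none of which contains an open neighborhood (in
  `C_I`) of any of its points."
* v2 p.15 L10–14 (proof of Lemma 3.3): "We shall prove the following equivalent statement. For any `J` anti-commuting with
  `I` and any nonzero alternating form `Ω` on `V_ℝ` there is a neighborhood `U_Ω ⊂ C_I` of `J` such that the locus `Compl_Ω`
  intersects `U_Ω` along a real-analytic subvariety of positive codimension. If `J ∉ Compl_Ω` there is nothing to prove.
  Assume `J ∈ Compl_Ω`."
* v2 p.15 L16–40: "Consider the orbit of `J` under the conjugation action of `G_I`: `G_I·J ≅ G_I/G_ℍ`. Let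
  `Ψ : G_I → Compl, g ↦ ᵍJ = gJg⁻¹`, be the evaluation map of the action. Put `D_{I,J,Ω} := Ψ⁻¹(Compl_Ω)` … Let `g(τ)` be
  any curve in `D_{I,J,Ω}` with tangent vector `X := g′(0)` … differentiating the constant function `ᵗ(^{g(τ)}J)Ω(^{g(τ)}J)`
  at `τ = 0` we obtain … `ᵗ(Xᴶ − X)Ω + Ω(Xᴶ − X) = 0`, where `Xᴶ := J⁻¹XJ = JXJ⁻¹`. So, denoting `Y := Xᴶ − X`, we obtain
  the equality (5) `ᵗYΩ + ΩY = 0`, where `Y` commutes with `I` and anticommutes with `J`."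
* v2 p.15 L40–50: "Note that for any `X ∈ T_eG_I`, `X = ½(X + Xᴶ) + ½(X − Xᴶ)`, where `X + Xᴶ ∈ T_eG_I` commutes with `J`
  and `X − Xᴶ ∈ T_eG_I` anticommutes with `J`. The tangent space `T_eG_ℍ` is the subspace of elements of `T_eG_I` that
  commute with `J`. Hence, the subspace of `Y`'s in `T_eG_I` anticommuting with `J` maps isomorphically onto the quotient
  space `V_I := T_eG_I/T_eG_ℍ ≅ T_J(G_I·J)` under the quotient map `T_eG_I → V_I`. So we need to check that for a nonzero
  `Ω` the space of solutions to (5), which is naturally identified with `T_J(G_I·J ∩ Compl_Ω)`, has dimension strictly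
  less than `dim_ℝ T_J(G_I·J) = dim_ℝ V_I = 4n²` (i.e., not all of the orbit `G_I·J` lies in `Compl_Ω`)."
* v2 p.15 L51–p.16 L7: conjugating (5) by `I` "we may assume that `Ω` is either `I`-invariant or `I`-anti-invariant";
  p.16 L8–162: the `I`-invariant case by a `4 × 4`-block computation in a basis `⟨v, Jv, Iv, JIv⟩` adapted to the spectral
  decomposition of the skew operator `Ω`, "So the codimension of the space of solutions of (6) is at least `4(n − 1)` … so
  that the codimension is at least `4n − 3`"; p.16 L163–166: "Case of `I`-anti-invariant `Ω`: This is done similarly and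
  leads to the same codimension bound `⩾ 4n − 3`. Alternatively, one could note that, if `C_I ⊂ Compl_Ω`, then, in
  particular, `±I ∈ Compl_Ω`, so that `Ω` is `I`-invariant, and this is the only case we need consider."

## What is formalised (`F` = `V_ℝ`, a real normed space, finite-dimensional where the block basis is used; `I, J : F →L[ℝ] F`
## with `I² = J² = −1`, `JI = −IJ`; `Ω : F →L[ℝ] F →L[ℝ] ℝ` a bilinear form; "`Y` solves (5)" = `∀ u v, Ω (Y u) v + Ω u (Y v)
## = 0`, i.e. `ᵗYΩ + ΩY = 0`; all statements basis-free)

* §1 the printed set-up: `Y = Xᴶ − X = −JXJ − X` commutes with `I` and anticommutes with `J` for `X ∈ T_eG_I`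
  (`conjJ_sub_comm_anti`); the splitting `X = ½(X + Xᴶ) + ½(X − Xᴶ)` of `T_eG_I` into `T_eG_ℍ ⊕ {Y | YI = IY, YJ = −JY}`
  (`split_comm_I`; uniqueness — an operator both commuting and anticommuting with `J` vanishes — is the companion leaf
  `TwistorPathDifferential.lean`'s `eq_zero_of_comm_of_anti`, not restated here) — "the subspace of `Y`'s … maps isomorphically
  onto `V_I`".
* §2 **`exists_anticommuting_pair_comm`** (finite dimension): `T_eG_ℍ = gl(V, ℍ)` contains operators `B₁, B₂` commuting with
  `I` and `J` with `B₁² = B₂² = −1`, `B₂B₁ = −B₁B₂` — in the block basis `{v, Jv, Iv, IJv}` of the tree's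
  `ComplexStructure.exists_pairAdapted_basis` (Buskin–Izadi's `⟨v, Iv, Jv, IJv⟩`, proof of Prop. 1.3; "such a basis is the
  union of sets of vectors of the form `{v, Jv, Iv, JIv}`", v1's proof of the lemma) they are the right multiplications by
  `j` and `i`, `B₁v = Jv`, `B₂v = Iv` block by block.
* §3 **Lemma 3.3, the statement the printed proof reduces it to** ("we need to check that for a nonzero `Ω` the space of
  solutions to (5) … has dimension strictly less than `dim_ℝ V_I` (i.e., not all of the orbit `G_I·J` lies in `Compl_Ω`)"):
  **`eq_zero_of_forall_skew`** — if EVERY `Y` with `YI = IY`, `YJ = −JY` solves (5) then `Ω = 0` — and its existence form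
  **`exists_not_skew`** — for `Ω ≠ 0` some such `Y` violates (5), so the solution space of (5) is a proper subspace of
  `{Y | YI = IY, YJ = −JY} ≅ V_I = T_J(G_I·J)`. OUR ROAD, in place of the printed `4 × 4`-block count (which gives the sharper
  codimension `≥ 4n − 3`, not formalised): Step 1 `invariant_I_of_forall_skew` — `Y = I` qualifies, so `Ω` is `I`-invariant
  (the paper's closing remark, p.16 L164–166); Step 2 `selfAdjoint_of_forall_skew` — `Y = BI` qualifies for every
  `B ∈ T_eG_ℍ`, which with Step 1 makes every `B ∈ T_eG_ℍ` `Ω`-self-adjoint, `Ω(Bu, v) = Ω(u, Bv)`; Step 3 — for the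
  anticommuting pair of §2, self-adjointness of `B₁`, `B₂` and `[B₁, B₂] = 2B₁B₂ ∈ T_eG_ℍ` gives `Ω(B₁B₂u, v) =
  −Ω(B₁B₂u, v)`, and `B₁B₂` is invertible. The hypotheses "`Ω` alternating" and "`J ∈ Compl_Ω`" of the printed setting are not
  needed for this step and are not assumed (a harmless generalisation: the conclusion is the printed one for every bilinear
  `Ω ≠ 0`).

## What is NOT here

`Compl`, `C_I`, `Compl_Ω`, `D_{I,J,Ω}` as subsets / real-analytic sets, the evaluation map `Ψ` and the derivation of (5) by
differentiating along a curve (we START from (5) as the paper states it), the identification of the solution space with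
`T_J(G_I·J ∩ Compl_Ω)` and the conclusion "real-analytic subvariety of positive codimension" (differential / analytic
geometry), the sharper printed bound codim `≥ 4n − 3`, Lemma 3.2 (analyticity of `S` and `Compl_Ω`; its form-level shadow —
a non-invariant 2-form is of type (1,1) for at most two antipodal points of a twistor sphere — is the tree's
`IsotropyAlgebraAction.eq_or_eq_neg_of_adAlt_twistorOp_eq_zero` on the hyperkähler carrier, not restated here), Lemma 3.4 (Baire
category) and Prop. 3.1 itself. The companion leaf `TwistorPathDifferential.lean` of the same seat treats §2 (Prop. 2.1, Cor. 2.4,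
Prop. 2.5); nothing is shared between the two files beyond Mathlib.

## References

* [BuskinIzadi2020TwistorLinesTori] N. Buskin, E. Izadi, *Twistor lines in the period domain of complex tori*, Geom.
  Dedicata 213 (2021) 21–47 = arXiv:1806.07831v2, §3.2 (Lemmas 3.2–3.4, proof of Lemma 3.3 with eq. (5), pp. 14–16), §3.1
  Prop. 3.1 (p.13 L24–25), §1.3–§1.4 (p.6: the basis `⟨v, Iv, Jv, IJv⟩`, `G_ℍ ≅ GL(V, ℍ)`) — read on the v2 PDF text layer
  (pp. 13–16) and in the corpus text of v1 (`paper:arxiv-1806.07831`, chunks p0010–p0012, where the same lemma is "Lemma 3.4"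
  and its proof carries the block basis sentence quoted in §2).
-/

noncomputable section

open Module

namespace Literature.Geometry.Hyperkaehler.TwistorConeLocus

variable {F : Type*} [NormedAddCommGroup F] [NormedSpace ℝ F]

/-! ### §1 The tangent vectors `Y = Xᴶ − X`: `T_eG_I = T_eG_ℍ ⊕ {Y | YI = IY, YJ = −JY}` -/

/-- For `X ∈ T_eG_I` (commuting with `I`), `Y := Xᴶ − X = −JXJ − X` commutes with `I` and ANTIcommutes with `J`
("denoting `Y := Xᴶ − X` … where `Y` commutes with `I` and anticommutes with `J`").
[cite: BuskinIzadi2020TwistorLinesTori, v2 §3.2, proof of Lemma 3.3 (p.15 L34–40)] -/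
theorem conjJ_sub_comm_anti {I J X : F →L[ℝ] F} (hJ : ∀ v, J (J v) = -v) (hIJ : ∀ v, J (I v) = -I (J v))
    (hX : ∀ v, X (I v) = I (X v)) :
    (∀ v, (-J.comp (X.comp J) - X) (I v) = I ((-J.comp (X.comp J) - X) v)) ∧
      ∀ v, (-J.comp (X.comp J) - X) (J v) = -J ((-J.comp (X.comp J) - X) v) := by
  refine ⟨fun v ↦ ?_, fun v ↦ ?_⟩
  · simp only [_root_.sub_apply, _root_.neg_apply, ContinuousLinearMap.coe_comp, Function.comp_apply, hIJ, map_neg,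
      hX, neg_neg, map_sub]
  · simp only [_root_.sub_apply, _root_.neg_apply, ContinuousLinearMap.coe_comp, Function.comp_apply, hJ, map_neg,
      neg_neg, map_sub]
    abel

/-- "Note that for any `X ∈ T_eG_I`, `X = ½(X + Xᴶ) + ½(X − Xᴶ)`, where `X + Xᴶ ∈ T_eG_I` commutes with `J` and
`X − Xᴶ ∈ T_eG_I` anticommutes with `J`" (`Xᴶ = J⁻¹XJ = −JXJ`): the splitting `T_eG_I = T_eG_ℍ ⊕ {Y | YI = IY, YJ = −JY}`,
so that the `J`-anticommuting part of `T_eG_I` "maps isomorphically onto the quotient space `V_I := T_eG_I/T_eG_ℍ`".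
[cite: BuskinIzadi2020TwistorLinesTori, v2 §3.2, proof of Lemma 3.3 (p.15 L40–47)] -/
theorem split_comm_I {I J X : F →L[ℝ] F} (hJ : ∀ v, J (J v) = -v) (hIJ : ∀ v, J (I v) = -I (J v))
    (hX : ∀ v, X (I v) = I (X v)) :
    X = (1 / 2 : ℝ) • (X - J.comp (X.comp J)) + (1 / 2 : ℝ) • (X + J.comp (X.comp J)) ∧
      ((∀ v, ((1 / 2 : ℝ) • (X - J.comp (X.comp J))) (I v) = I (((1 / 2 : ℝ) • (X - J.comp (X.comp J))) v)) ∧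
        ∀ v, ((1 / 2 : ℝ) • (X - J.comp (X.comp J))) (J v) = J (((1 / 2 : ℝ) • (X - J.comp (X.comp J))) v)) ∧
      ((∀ v, ((1 / 2 : ℝ) • (X + J.comp (X.comp J))) (I v) = I (((1 / 2 : ℝ) • (X + J.comp (X.comp J))) v)) ∧
        ∀ v, ((1 / 2 : ℝ) • (X + J.comp (X.comp J))) (J v) = -J (((1 / 2 : ℝ) • (X + J.comp (X.comp J))) v)) := by
  refine ⟨by module, ⟨fun v ↦ ?_, fun v ↦ ?_⟩, fun v ↦ ?_, fun v ↦ ?_⟩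
  all_goals
    simp only [_root_.smul_apply, _root_.sub_apply, _root_.add_apply, ContinuousLinearMap.coe_comp,
      Function.comp_apply, hIJ, hJ, map_neg, hX, neg_neg, map_sub, map_add, map_smul]
  all_goals module

/-! ### §2 Two anticommuting complex structures INSIDE `T_eG_ℍ = gl(V, ℍ)` (right multiplications by `j` and `i`
### in an adapted basis `{v, Jv, Iv, IJv}`) -/

/-- **`gl(V, ℍ)` contains a pair of anticommuting complex structures** (finite-dimensional `V_ℝ`): there are `B₁, B₂`
commuting with both `I` and `J` with `B₁² = B₂² = −1`, `B₂B₁ = −B₁B₂` — in a basis of `V_ℝ` made of blocks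
`{v, Jv, Iv, IJv}` ("Such a basis is the union of sets of vectors of the form `{v, Jv, Iv, JIv}`", the block basis of the
proof of Lemma 3.3 / Prop. 1.3; the tree's `ComplexStructure.exists_pairAdapted_basis`) they are the right multiplications
by `j` and by `i` of the quaternionic structure, block by block: `B₁v = Jv`, `B₂v = Iv`.
[cite: BuskinIzadi2020TwistorLinesTori, v2 §1.4 (p.6 L54–56: "`G_{I,J} ≅ GL(V, ℍ)` which we will also denote by `G_ℍ`"),
§3.2 proof of Lemma 3.3 (p.15 L15–17), §1.3 proof of Prop. 1.3 (p.6 L44–49: the basis `⟨v, Iv, Jv, IJv⟩`)] -/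
theorem exists_anticommuting_pair_comm [FiniteDimensional ℝ F] {I J : F →L[ℝ] F} (hI : ∀ v, I (I v) = -v)
    (hJ : ∀ v, J (J v) = -v) (hIJ : ∀ v, J (I v) = -I (J v)) :
    ∃ B₁ B₂ : F →L[ℝ] F, (∀ v, B₁ (I v) = I (B₁ v)) ∧ (∀ v, B₁ (J v) = J (B₁ v)) ∧ (∀ v, B₂ (I v) = I (B₂ v)) ∧
      (∀ v, B₂ (J v) = J (B₂ v)) ∧ (∀ v, B₁ (B₁ v) = -v) ∧ (∀ v, B₂ (B₂ v) = -v) ∧ ∀ v, B₂ (B₁ v) = -B₁ (B₂ v) := by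
  obtain ⟨m, e, r, hr⟩ := ComplexStructure.exists_pairAdapted_basis I J hI hJ hIJ
  -- the action of `I` and `J` on the basis `r ((β₁, β₂), a) = I^{β₁} J^{β₂} e_a`
  have tI0 : ∀ β a, I (r ((false, β), a)) = r ((true, β), a) := fun β a ↦ by rw [hr, hr]; rfl
  have tI1 : ∀ β a, I (r ((true, β), a)) = -r ((false, β), a) := fun β a ↦ by
    rw [hr, hr]; cases β <;> simp [hI]
  have tJ00 : ∀ a, J (r ((false, false), a)) = r ((false, true), a) := fun a ↦ by rw [hr, hr]; rfl
  have tJ01 : ∀ a, J (r ((false, true), a)) = -r ((false, false), a) := fun a ↦ by rw [hr, hr]; simp [hJ]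
  have tJ10 : ∀ a, J (r ((true, false), a)) = -r ((true, true), a) := fun a ↦ by rw [hr, hr]; simp [hIJ]
  have tJ11 : ∀ a, J (r ((true, true), a)) = r ((true, false), a) := fun a ↦ by rw [hr, hr]; simp [hIJ, hJ]
  -- `B₁` = right multiplication by `j`: `B₁ (I^β e) = I^β J e`, `B₁ (I^β J e) = −I^β e`
  let f₁ : (Bool × Bool) × Fin m → F := fun s ↦
    match s with
    | ((β, false), a) => r ((β, true), a)
    | ((β, true), a) => -r ((β, false), a)
  -- `B₂` = right multiplication by `i`: `B₂ e = I e`, `B₂ (J e) = −IJ e`, `B₂ (I e) = −e`, `B₂ (IJ e) = J e`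
  let f₂ : (Bool × Bool) × Fin m → F := fun s ↦
    match s with
    | ((false, false), a) => r ((true, false), a)
    | ((false, true), a) => -r ((true, true), a)
    | ((true, false), a) => -r ((false, false), a)
    | ((true, true), a) => r ((false, true), a)
  let B₁ : F →L[ℝ] F := LinearMap.toContinuousLinearMap (r.constr ℝ f₁)
  let B₂ : F →L[ℝ] F := LinearMap.toContinuousLinearMap (r.constr ℝ f₂)
  have hB₁ : ∀ s, B₁ (r s) = f₁ s := fun s ↦ by simp only [B₁, LinearMap.coe_toContinuousLinearMap', Basis.constr_basis]
  have hB₂ : ∀ s, B₂ (r s) = f₂ s := fun s ↦ by simp only [B₂, LinearMap.coe_toContinuousLinearMap', Basis.constr_basis]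
  -- the seven relations on the basis
  have e1 : ∀ s, B₁ (I (r s)) = I (B₁ (r s)) := by
    rintro ⟨⟨β₁, β₂⟩, a⟩
    cases β₁ <;> cases β₂ <;> simp only [hB₁, f₁, tI0, tI1, map_neg, neg_neg]
  have e2 : ∀ s, B₁ (J (r s)) = J (B₁ (r s)) := by
    rintro ⟨⟨β₁, β₂⟩, a⟩
    cases β₁ <;> cases β₂ <;> simp only [hB₁, f₁, tJ00, tJ01, tJ10, tJ11, map_neg, neg_neg]
  have e3 : ∀ s, B₂ (I (r s)) = I (B₂ (r s)) := by
    rintro ⟨⟨β₁, β₂⟩, a⟩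
    cases β₁ <;> cases β₂ <;> simp only [hB₂, f₂, tI0, tI1, map_neg, neg_neg]
  have e4 : ∀ s, B₂ (J (r s)) = J (B₂ (r s)) := by
    rintro ⟨⟨β₁, β₂⟩, a⟩
    cases β₁ <;> cases β₂ <;> simp only [hB₂, f₂, tJ00, tJ01, tJ10, tJ11, map_neg]
  have e5 : ∀ s, B₁ (B₁ (r s)) = -r s := by
    rintro ⟨⟨β₁, β₂⟩, a⟩
    cases β₁ <;> cases β₂ <;> simp only [hB₁, f₁, map_neg]
  have e6 : ∀ s, B₂ (B₂ (r s)) = -r s := by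
    rintro ⟨⟨β₁, β₂⟩, a⟩
    cases β₁ <;> cases β₂ <;> simp only [hB₂, f₂, map_neg]
  have e7 : ∀ s, B₂ (B₁ (r s)) = -B₁ (B₂ (r s)) := by
    rintro ⟨⟨β₁, β₂⟩, a⟩
    cases β₁ <;> cases β₂ <;> simp only [hB₁, hB₂, f₁, f₂, map_neg, neg_neg]
  -- from the basis to all vectors
  refine ⟨B₁, B₂, fun v ↦ ?_, fun v ↦ ?_, fun v ↦ ?_, fun v ↦ ?_, fun v ↦ ?_, fun v ↦ ?_, fun v ↦ ?_⟩
  · have key : ((B₁ : F →ₗ[ℝ] F) ∘ₗ (I : F →ₗ[ℝ] F)) = (I : F →ₗ[ℝ] F) ∘ₗ (B₁ : F →ₗ[ℝ] F) :=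
      r.ext fun s ↦ by simpa using e1 s
    simpa using LinearMap.congr_fun key v
  · have key : ((B₁ : F →ₗ[ℝ] F) ∘ₗ (J : F →ₗ[ℝ] F)) = (J : F →ₗ[ℝ] F) ∘ₗ (B₁ : F →ₗ[ℝ] F) :=
      r.ext fun s ↦ by simpa using e2 s
    simpa using LinearMap.congr_fun key v
  · have key : ((B₂ : F →ₗ[ℝ] F) ∘ₗ (I : F →ₗ[ℝ] F)) = (I : F →ₗ[ℝ] F) ∘ₗ (B₂ : F →ₗ[ℝ] F) :=
      r.ext fun s ↦ by simpa using e3 s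
    simpa using LinearMap.congr_fun key v
  · have key : ((B₂ : F →ₗ[ℝ] F) ∘ₗ (J : F →ₗ[ℝ] F)) = (J : F →ₗ[ℝ] F) ∘ₗ (B₂ : F →ₗ[ℝ] F) :=
      r.ext fun s ↦ by simpa using e4 s
    simpa using LinearMap.congr_fun key v
  · have key : ((B₁ : F →ₗ[ℝ] F) ∘ₗ (B₁ : F →ₗ[ℝ] F)) = -LinearMap.id := r.ext fun s ↦ by simpa using e5 s
    simpa using LinearMap.congr_fun key v
  · have key : ((B₂ : F →ₗ[ℝ] F) ∘ₗ (B₂ : F →ₗ[ℝ] F)) = -LinearMap.id := r.ext fun s ↦ by simpa using e6 s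
    simpa using LinearMap.congr_fun key v
  · have key : ((B₂ : F →ₗ[ℝ] F) ∘ₗ (B₁ : F →ₗ[ℝ] F)) = -((B₁ : F →ₗ[ℝ] F) ∘ₗ (B₂ : F →ₗ[ℝ] F)) :=
      r.ext fun s ↦ by simpa using e7 s
    simpa using LinearMap.congr_fun key v

/-! ### §3 Lemma 3.3: for `Ω ≠ 0` not every `Y` with `YI = IY`, `YJ = −JY` solves `ᵗYΩ + ΩY = 0` -/

/-- Step 1 ("if `C_I ⊂ Compl_Ω`, then, in particular, `±I ∈ Compl_Ω`, so that `Ω` is `I`-invariant"): `Y = I` itself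
commutes with `I` and anticommutes with `J`, so if every such `Y` solves (5) then `Ω(I·, ·) + Ω(·, I·) = 0`, hence
`Ω(I·, I·) = Ω`. [cite: BuskinIzadi2020TwistorLinesTori, v2 §3.2, proof of Lemma 3.3 (p.16 L164–166)] -/
theorem invariant_I_of_forall_skew {I J : F →L[ℝ] F} (hI : ∀ v, I (I v) = -v) (hIJ : ∀ v, J (I v) = -I (J v))
    {Ω : F →L[ℝ] F →L[ℝ] ℝ}
    (H : ∀ Y : F →L[ℝ] F, (∀ v, Y (I v) = I (Y v)) → (∀ v, Y (J v) = -J (Y v)) → ∀ u v, Ω (Y u) v + Ω u (Y v) = 0)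
    (u v : F) : Ω (I u) (I v) = Ω u v := by
  have h := H I (fun v ↦ rfl) (fun v ↦ by rw [hIJ, neg_neg]) u (I v)
  rw [hI, map_neg] at h
  linear_combination h

/-- Step 2: if every `Y` with `YI = IY`, `YJ = −JY` solves (5), then every `B ∈ T_eG_ℍ` is SELF-ADJOINT for `Ω`,
`Ω(Bu, v) = Ω(u, Bv)`: apply (5) to `Y = BI` at `(Iu, v)` and use Step 1.
[cite: BuskinIzadi2020TwistorLinesTori, v2 §3.2, proof of Lemma 3.3 (p.15 L38–50, eq. (5))] -/
theorem selfAdjoint_of_forall_skew {I J B : F →L[ℝ] F} (hI : ∀ v, I (I v) = -v) (hIJ : ∀ v, J (I v) = -I (J v))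
    {Ω : F →L[ℝ] F →L[ℝ] ℝ}
    (H : ∀ Y : F →L[ℝ] F, (∀ v, Y (I v) = I (Y v)) → (∀ v, Y (J v) = -J (Y v)) → ∀ u v, Ω (Y u) v + Ω u (Y v) = 0)
    (hBI : ∀ v, B (I v) = I (B v)) (hBJ : ∀ v, B (J v) = J (B v)) (u v : F) :
    Ω (B u) v = Ω u (B v) := by
  -- `Y = B ∘ I` commutes with `I` and anticommutes with `J`
  have h := H (B.comp I) (fun w ↦ by simp [hBI]) (fun w ↦ by simp [hIJ, hBI, hBJ]) (I u) v
  simp only [ContinuousLinearMap.coe_comp, Function.comp_apply, hI, map_neg, _root_.neg_apply] at h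
  -- h : -Ω (B u) v + Ω (I u) (B (I v)) = 0, and the second term is `Ω u (B v)` by Step 1
  have e : Ω (I u) (B (I v)) = Ω u (B v) := by rw [hBI]; exact invariant_I_of_forall_skew hI hIJ H u (B v)
  linear_combination e - h

/-- **Lemma 3.3 (Buskin–Izadi), the linear algebra: "we need to check that for a nonzero `Ω` the space of solutions
to (5) [`ᵗYΩ + ΩY = 0`, `Y` commuting with `I` and anticommuting with `J`], which is naturally identified with
`T_J(G_I·J ∩ Compl_Ω)`, has dimension strictly less than `dim_ℝ T_J(G_I·J) = dim_ℝ V_I = 4n²` (i.e., not all of the orbit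
`G_I·J` lies in `Compl_Ω`)."** Contrapositive form, for ANY real bilinear form `Ω` on a finite-dimensional `V_ℝ` with a
quaternionic pair `I, J`: if every `Y` with `YI = IY`, `YJ = −JY` solves (5), then `Ω = 0`. OUR ROAD (the print reaches
codimension `≥ 4n − 3` by a `4 × 4`-block computation with the spectral decomposition of `Ω`; the lemma needs only
codimension `≥ 1`): by Steps 1–2 every `B ∈ T_eG_ℍ = gl(V, ℍ)` is `Ω`-self-adjoint; but `gl(V, ℍ)` contains an
anticommuting pair `B₁, B₂` (§2), and self-adjointness of `B₁, B₂` and of `B₁B₂ − B₂B₁ = 2B₁B₂ ∈ gl(V, ℍ)` forces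
`Ω(B₁B₂·, ·) = 0` with `B₁B₂` invertible, so `Ω = 0`. Neither the alternation nor the `J`-invariance of `Ω` is used.
[cite: BuskinIzadi2020TwistorLinesTori, v2 §3.2 Lemma 3.3 (p.14 L44–45: "For any nonzero alternating form `Ω`, the cone `C_I`
is not contained in `Compl_Ω`"), proof p.15 L10–p.16 L166 (the reduction to (5), p.15 L27–50)] -/
theorem eq_zero_of_forall_skew [FiniteDimensional ℝ F] {I J : F →L[ℝ] F} (hI : ∀ v, I (I v) = -v)
    (hJ : ∀ v, J (J v) = -v) (hIJ : ∀ v, J (I v) = -I (J v)) {Ω : F →L[ℝ] F →L[ℝ] ℝ}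
    (H : ∀ Y : F →L[ℝ] F, (∀ v, Y (I v) = I (Y v)) → (∀ v, Y (J v) = -J (Y v)) → ∀ u v, Ω (Y u) v + Ω u (Y v) = 0) :
    Ω = 0 := by
  obtain ⟨B₁, B₂, h1I, h1J, h2I, h2J, h11, h22, h21⟩ := exists_anticommuting_pair_comm hI hJ hIJ
  have sa := fun {B : F →L[ℝ] F} (hBI : ∀ v, B (I v) = I (B v)) (hBJ : ∀ v, B (J v) = J (B v)) ↦
    selfAdjoint_of_forall_skew hI hIJ H hBI hBJ
  -- the commutator `[B₁, B₂] = 2B₁B₂` is also in `T_eG_ℍ`, hence `Ω`-self-adjoint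
  have hCI : ∀ v, (B₁.comp B₂ - B₂.comp B₁) (I v) = I ((B₁.comp B₂ - B₂.comp B₁) v) := fun v ↦ by
    simp [h1I, h2I]
  have hCJ : ∀ v, (B₁.comp B₂ - B₂.comp B₁) (J v) = J ((B₁.comp B₂ - B₂.comp B₁) v) := fun v ↦ by
    simp [h1J, h2J]
  have hzero : ∀ u v, Ω (B₁ (B₂ u)) v = 0 := fun u v ↦ by
    have a1 : Ω u (B₁ (B₂ v)) = Ω (B₂ (B₁ u)) v := by rw [← sa h1I h1J, ← sa h2I h2J]
    have a3 := sa hCI hCJ u v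
    simp only [_root_.sub_apply, ContinuousLinearMap.coe_comp, Function.comp_apply, h21, map_neg, _root_.neg_apply,
      sub_neg_eq_add, map_add, _root_.add_apply] at a3 a1
    -- a1 : Ω u (B₁ (B₂ v)) = -Ω (B₁ (B₂ u)) v;  a3 : 2·Ω (B₁ (B₂ u)) v = 2·Ω u (B₁ (B₂ v))
    linear_combination (a3 + 2 * a1) / 4
  -- `B₁B₂` is invertible (`B₁² = B₂² = −1`), so `Ω = 0`
  ext u w
  have hu : B₁ (B₂ (B₂ (B₁ u))) = u := by rw [h22, map_neg, h11, neg_neg]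
  have := hzero (B₂ (B₁ u)) w
  rw [hu] at this
  simpa using this

/-- **Lemma 3.3, existence form: "not all of the orbit `G_I·J` lies in `Compl_Ω`"** at the tangent space. For a
quaternionic pair `I, J` on a finite-dimensional `V_ℝ` and a NONZERO bilinear form `Ω` there is a tangent direction
`Y ∈ {YI = IY, YJ = −JY} ≅ V_I = T_J(G_I·J)` that violates (5): `Ω(Yu, v) + Ω(u, Yv) ≠ 0` for some `u, v` — the solution
space of (5) is a PROPER subspace of `V_I`. [cite: BuskinIzadi2020TwistorLinesTori, v2 §3.2 Lemma 3.3 (p.14 L44–45),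
proof p.15 L47–50 ("has dimension strictly less than `dim_ℝ T_J(G_I·J) = dim_ℝ V_I`")] -/
theorem exists_not_skew [FiniteDimensional ℝ F] {I J : F →L[ℝ] F} (hI : ∀ v, I (I v) = -v)
    (hJ : ∀ v, J (J v) = -v) (hIJ : ∀ v, J (I v) = -I (J v)) {Ω : F →L[ℝ] F →L[ℝ] ℝ} (hΩ : Ω ≠ 0) :
    ∃ Y : F →L[ℝ] F, (∀ v, Y (I v) = I (Y v)) ∧ (∀ v, Y (J v) = -J (Y v)) ∧ ∃ u v, Ω (Y u) v + Ω u (Y v) ≠ 0 := by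
  by_contra hcon
  refine hΩ (eq_zero_of_forall_skew hI hJ hIJ fun Y hYI hYJ u v ↦ ?_)
  by_contra huv
  exact hcon ⟨Y, hYI, hYJ, u, v, huv⟩

end Literature.Geometry.Hyperkaehler.TwistorConeLocus
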